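import Literature.NumberTheory.Rogawski1990.KottwitzSignTwistedFrame
import Literature.NumberTheory.Rogawski1990.SingularLocalRealisation
import Literature.NumberTheory.Automorphic.QuadraticHeckeCharacterLocalComponent
import Literature.NumberTheory.Automorphic.TorusCharacterLocalComponents
import Literature.NumberTheory.Automorphic.ClassFieldCharacterLocal
import Literature.NumberTheory.Automorphic.UnitaryGroupBorelInduction
import HarnessLib

/-!
# «`μ|_{C_F} = ω_{E/F}`» read SEMI-LOCALLY: the semi-local components of a Hecke character of the CM field `L` whose
# pull-back to `𝕀_{L⁺}` is the quadratic character `ε_{L/L⁺}` satisfy `IsQuadraticCharExtension` at every finite place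

Topic `NumberTheory/Rogawski1990`; namespace `Literature.NumberTheory.Rogawski1990`.  THEOREMS ONLY (no definition, no instance, no
notation, no named fact, no `sorry`).

THE PRINT.  Rogawski, *Automorphic Representations of Unitary Groups in Three Variables* (1990), §4.8 p. 51: «let `μ` be a fixed
character of `C_E` whose restriction to `C_F` is `ω_{E/F}`»; §12.2 case (2) p. 173 reads this hypothesis LOCALLY: `μ_v|_{F_v^×}` is the
quadratic character `ω_{E_v/F_v}` of the local extension, i.e. trivial exactly on the local norms — the tree's predicate ★
`UnitaryGroup.IsQuadraticCharExtension σ μ := ∀ x, σ x = x → (μ x = 1 ↔ ∃ y, σ y · y = x)` on the semi-local ring `L ⊗ L⁺_v = ∏_{w ∣ v} L_w`.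
The cell `hodgecm-mathlib` (F0∕P3, crux H413) posits this local reading as the binder `hquad` of the ED. 4 closer's `stub_rung0` ∕ `Q_K9`
(and of ★ `Rogawski1990.XiPinSphericalCofinite`'s consumers), next to the GLOBAL hypothesis
`hμω : ∀ x, μω (ideleBaseChange x) = quadraticHeckeCharCM L x`.  This file derives the local reading from the global one — at EVERY
finite place `v` of `L⁺`, split or not — by assembling ★ results already in the tree:

* ★ `exists_toLocalRing_eq_of_conjLocal_eq` (`SingularLocalRealisation`): `σ_v`-fixed elements of `L ⊗ L⁺_v` come from `L⁺_v`;
* ★ `ideleBaseChange_localUnits` (`ClassFieldCharacterLocal`): the base change of the local idèle `⟨t⟩_v` is `∏_{w ∣ v} ⟨t⟩_w`, which is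
  ★ `semilocalUnits v (ι_v t)` (proved here: `semilocalUnits_toLocalRing`);
* ★ `quadraticHeckeChar_localUnits_eq_one_iff_mem` (`QuadraticHeckeCharacterLocalComponent`, Hilbert reciprocity inside): `ε(⟨t⟩_v) = 1`
  iff `t` is a local norm from `L⁺_v(√θ)`;
* ★ `exists_mul_conjLocal_eq_toLocalRing_iff` (`KottwitzSignTwistedFrame`): `t` is such a local norm iff `ι_v t = z · σ_v z` in `L ⊗ L⁺_v`.

Main result: **`isQuadraticCharExtension_semilocalComponent_of_baseChange_eq`**. [cite: Rogawski1990, §4.8 p. 51; §12.2 (2) p. 173]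

HC_CM is proved only modulo the printed citations until rung 0 closes; this file discharges the `hquad` binder of the rung-0 existential
(typ-T8 (g0) map `F0/P3/T8a-TREE.md`, `T8b-TREE.md`), nothing else.
-/

set_option autoImplicit false

noncomputable section

open scoped NumberField
open NumberField IsDedekindDomain

namespace Literature.NumberTheory.Rogawski1990

open Literature.NumberTheory.Automorphic Literature.NumberTheory.Automorphic.UnitaryGroup
open Literature.NumberTheory.GaloisRepresentations

variable {L : Type} [Field L] [NumberField L] [IsCMField L]

/-! ## §1 Units of `L⁺_v` inside `L ⊗ L⁺_v` -/

/-- A `σ_v`-fixed UNIT of `L ⊗ L⁺_v` is `ι_v t` for a unit `t` of `L⁺_v` (★ `exists_toLocalRing_eq_of_conjLocal_eq` applied to `x` and `x⁻¹`).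
[cite: Rogawski1990, §3.8 Prop. 3.8.1 (d) p. 30] -/
theorem exists_units_map_toLocalRing_eq_of_conjLocal_eq (v : HeightOneSpectrum (𝓞 ↥(maximalRealSubfield L)))
    (x : (UnitaryGroup.LocalRing L v)ˣ) (hx : UnitaryGroup.conjLocal L (IsCMField.complexConj L) v (x : UnitaryGroup.LocalRing L v) = x) :
    ∃ t : (v.adicCompletion ↥(maximalRealSubfield L))ˣ,
      Units.map (UnitaryGroup.toLocalRing L v : v.adicCompletion ↥(maximalRealSubfield L) →* UnitaryGroup.LocalRing L v) t = x := by
  set σv := UnitaryGroup.conjLocal L (IsCMField.complexConj L) v with hσv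
  obtain ⟨a, ha⟩ := exists_toLocalRing_eq_of_conjLocal_eq v hx
  have hxinv : σv (↑x⁻¹ : UnitaryGroup.LocalRing L v) = ↑x⁻¹ := by
    calc σv (↑x⁻¹ : UnitaryGroup.LocalRing L v)
        = σv ↑x⁻¹ * ((x : UnitaryGroup.LocalRing L v) * ↑x⁻¹) := by rw [Units.mul_inv, mul_one]
      _ = σv ↑x⁻¹ * σv ↑x * ↑x⁻¹ := by rw [hx, mul_assoc]
      _ = σv (↑x⁻¹ * ↑x) * ↑x⁻¹ := by rw [map_mul]
      _ = ↑x⁻¹ := by rw [Units.inv_mul, map_one, one_mul]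
  obtain ⟨b, hb⟩ := exists_toLocalRing_eq_of_conjLocal_eq v hxinv
  have hab : a * b = 1 := UnitaryGroup.toLocalRing_injective L v (by rw [map_mul, ha, hb, map_one, Units.mul_inv])
  have hba : b * a = 1 := by rw [mul_comm]; exact hab
  exact ⟨⟨a, b, hab, hba⟩, Units.ext ha⟩

omit [IsCMField L] in
/-- **`semilocalUnits v (ι_v t) = (⟨t⟩_v)_L`**: the block idèle of `ι_v t ∈ (L ⊗ L⁺_v)ˣ` is the base change to `𝕀_L` of the local idèle `⟨t⟩_v ∈ 𝕀_{L⁺}`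
(★ `ideleBaseChange_localUnits`: both are `∏_{w ∣ v} ⟨t⟩_w`). [cite: CasselsFrohlichANT1967, Ch. II §14] -/
theorem semilocalUnits_toLocalRing (v : HeightOneSpectrum (𝓞 ↥(maximalRealSubfield L))) (t : (v.adicCompletion ↥(maximalRealSubfield L))ˣ) :
    semilocalUnits L v (Units.map (UnitaryGroup.toLocalRing L v : v.adicCompletion ↥(maximalRealSubfield L) →* UnitaryGroup.LocalRing L v) t) =
      AdeleRing.ideleBaseChange ↥(maximalRealSubfield L) L (localUnits v t) := by
  classical
  obtain ⟨c, hc, -⟩ := exists_localUnitsAbove (E := L) v t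
  rw [ideleBaseChange_localUnits (E := L) v t c hc
      ((Finset.univ : Finset (PlacesOver L v)).map ⟨Subtype.val, Subtype.val_injective⟩)
      (fun w => ⟨fun h => by obtain ⟨a, -, rfl⟩ := Finset.mem_map.1 h; exact a.2,
        fun h => Finset.mem_map.2 ⟨⟨w, h⟩, Finset.mem_univ _, rfl⟩⟩),
    semilocalUnits_apply, Finset.prod_map]
  refine Finset.prod_congr rfl fun w _ => ?_
  congr 1
  haveI := PlacesOver.liesOver w
  refine Units.ext ?_
  simp only [Function.Embedding.coeFn_mk]
  rw [hc w.1 w.2, MulEquiv.val_piUnits_apply, Units.coe_map, MonoidHom.coe_coe, UnitaryGroup.toLocalRing_apply]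
  rfl

/-! ## §2 The semi-local reading of «`μ|_{C_F} = ω_{E/F}`» -/

/-- **«`μ|_{F_v^×} = ω_{E_v/F_v}`» FROM «`μ|_{C_F} = ω_{E/F}`»**: if the Hecke character `μω` of the CM field `L` pulls back along `𝕀_{L⁺} → 𝕀_L`
to the quadratic character `ε_{L/L⁺}` (★ `quadraticHeckeCharCM`), then at EVERY finite place `v` of `L⁺` its semi-local component on
`(L ⊗ L⁺_v)ˣ` is trivial on a `σ_v`-fixed unit exactly when that unit is a norm `σ_v y · y` — ★ `IsQuadraticCharExtension`.  Assembly of ★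
`exists_toLocalRing_eq_of_conjLocal_eq`, `semilocalUnits_toLocalRing`, ★ `quadraticHeckeChar_localUnits_eq_one_iff_mem` (local component of `ε` =
local norm character, via Hilbert reciprocity) and ★ `exists_mul_conjLocal_eq_toLocalRing_iff` (local norm dictionary).
[cite: Rogawski1990, §4.8 p. 51; §12.2 (2) p. 173] [cite: Omeara1963, §65A Example 65:2] -/
theorem isQuadraticCharExtension_semilocalComponent_of_baseChange_eq (μω : HeckeCharacter L)
    (hμω : ∀ x : ideleGroup ↥(maximalRealSubfield L), μω (AdeleRing.ideleBaseChange ↥(maximalRealSubfield L) L x) = quadraticHeckeCharCM L x)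
    (v : HeightOneSpectrum (𝓞 ↥(maximalRealSubfield L))) :
    IsQuadraticCharExtension (UnitaryGroup.conjLocal L (IsCMField.complexConj L) v) (μω.semilocalComponent L v) := by
  intro x hx
  obtain ⟨t, rfl⟩ := exists_units_map_toLocalRing_eq_of_conjLocal_eq v x hx
  have hbridge : μω.semilocalComponent L v (Units.map (UnitaryGroup.toLocalRing L v :
      v.adicCompletion ↥(maximalRealSubfield L) →* UnitaryGroup.LocalRing L v) t) = quadraticHeckeCharCM L (localUnits v t) := by
    rw [semilocalComponent_apply, semilocalUnits_toLocalRing, ← hμω]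
  rw [hbridge, quadraticHeckeCharCM_def, quadraticHeckeChar_localUnits_eq_one_iff_mem, ← exists_mul_conjLocal_eq_toLocalRing_iff]
  constructor
  · rintro ⟨z, hz⟩
    have hzu : IsUnit z :=
      isUnit_of_mul_isUnit_left (y := UnitaryGroup.conjLocal L (IsCMField.complexConj L) v z) (by rw [hz]; exact (Units.map _ t).isUnit)
    refine ⟨hzu.unit, ?_⟩
    rw [IsUnit.unit_spec, mul_comm]
    exact hz
  · rintro ⟨y, hy⟩
    exact ⟨y, by rw [mul_comm]; exact hy⟩

end Literature.NumberTheory.Rogawski1990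

end
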